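/-
Copyright (c) 2026 the pub-hodgecm-mathlib formalisation cell (harness21).  Prover seat hodgecm-mathlib-F0P3a-p07 (g15) ((Cnt2′) chair): «S3-ram» seeding wave
(LEAD F0P3a-plan (g13); (α) block-law keeper F0P3a-p06 (g16)), organ «`stub_mdict`» = THE m ∕ N ∕ τ DICTIONARY of the (α) v1 block-law skeleton (chair RULING (13) (3)), PART 1∕2: the parity law and the Hensel bookkeeping; 2026-09-02.
-/
import Literature.NumberTheory.Rogawski1990.DepthZeroKappaTransferTypeTwoRamifiedSignDictionary   -- ★ p848151∕p848205 (B-p14): `quadraticChar_residue_eq_hilbertSymbol_typeTwo_of_sub_lt`; brings ★ `ramifiedBlock_adicCompletion`, ★ `hilbertSymbol_eq_{one,neg_one}_iff_…`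
import Literature.NumberTheory.Rogawski1990.FinExplicitTransferFactorDeepTauUniform          -- ★ `galAdicCompletionMap_{det_mul_det_eq_one, trace_mul_det_eq}`, ★ `conjLocal_finGammaTwo_mul_finGammaTwo`; brings ★ `eval_finCharpolyTwo_finGammaTwo_apply_eq_quadratic`
import Literature.NumberTheory.LocalFields.RamifiedPlaceNormDictionary                        -- ★ `isSquare_residue_iff_exists_valued_sub_sq_lt_one`; brings ★ `valued_toPlace_uniformizer_of_ramified`
import Literature.NumberTheory.Automorphic.AdicCompletionUnitNorms                            -- ★ `exists_sq_eq_of_sq_sub_mem_maximalIdeal` (Hensel, square roots)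
import Literature.NumberTheory.Rogawski1990.UnitFundamentalLemmaInertFlickerFrame             -- ★ `isUnit_two_integer_iff_valued_eq_one`
import HarnessLib

/-!
# The ramified type-(2) transfer, depth dictionary PART 1: the TRACE∕PARITY LAW «`v(2u − tr g)` even ⇒ `|2u − tr g| = |disc|`» and the Hensel bookkeeping
# (Rogawski 1990 §4.9; Labesse–Langlands 1979 §2; Serre, *Local Fields* IV §2, V §3, II §4)

Topic `NumberTheory/Rogawski1990`; namespace `Literature.NumberTheory.Rogawski1990` (+ `.TypeTwoRamifiedDepth` for the generic lemmas).  THEOREMS ONLY (no definition, no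
instance, no notation, no named fact, no `sorry`); kernel lane `--supports stmt-HodgeConjecture-24833`.  Cell `pub/hodgecm-mathlib` (D-0151), crux H413; road «S3-ram»
(count-neutral), the (Cnt2′) block laws `stub_T2G_{zero,pm}_{even,odd}_block` (chair skeleton v4.3 ⟸ ★ p848712∕p848727) ⟸ (α) v1 `J0diff := rcases stub_mdict; rw [stub_Zhyp,
stub_Zaniso]; BlockLawArith.…` (keeper F0P3a-p06 (g16), closers ★ p849020 F0P3a-p03 (g18)).  THIS FILE IS `stub_mdict`: from the J0diff binders ALONE (`hblk hu2 hirr hdisc hn hm hβ`)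
it derives the regime dictionary the branch split needs.

THE MATHEMATICS (`K = L_w`, `σ = σ_w`, `w ∣ v` tame ramified non-split, `ϖ` anti-fixed uniformiser; `g = g_w ∈ U(Φ₂)(K)` 2-deep with `t = tr g`, `δ = det g`, IRREDUCIBLE
characteristic polynomial, `D = t² − 4δ`, `|D| = |ϖ|^{2N}`; `u = u_w`, `σu·u = 1`, 2-deep; `c = χ_g(u) = u² − tu + δ`, `|c| = |ϖ|^{2m}`; `x := 2u − t`; `ι_w β = −c(u² + δ)∕(2u²δ)`,
`τ := (β, θ)_v`).  Unitarity gives `σ(δ)δ = 1` and `σ(t)δ = t` (★ `galAdicCompletionMap_{det_mul_det_eq_one,trace_mul_det_eq}`), hence the EXACT identity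
**`σ(x)·uδ + x = 2·det(g − 1) − (t − 2)(u − 1)`** and **`D = −(t − 2)·x − 2·(2·det(g − 1) − (t − 2)(u − 1))`** (`det(g − 1) = δ − t + 1`).
* §1 `valued_map_sub_lt_of_valued_eq_pow_two_mul` — RESIDUAL PARITY at a tame ramified place: `|x| = |ϖ|^{2k}` ⇒ `|σx − x| < |x|` (`σ` is trivial on the residue field,
  `σ(ϖ^{2k}) = ϖ^{2k}`).  `valued_trace_sq_sub_four_det_eq_of_valued_map_sub_lt` — **THE TRACE LAW**: if `|σx − x| < |x|` then `|D| = |x|` (the identity above: `|uδ − 1| < 1`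
  makes `|2det(g−1) − (t−2)(u−1)| = |2x| = |x|`, and `|t − 2| < 1`).  So an `x` of EVEN order has `|x| = |D|`: **`v(2u − t) < N ⇒ v(2u − t)` is ODD**, and `v(2u − t) = N` is
  impossible for `N` even (`N ≥ 1`) — with no splitting field, no eigenvalues, no norm-one group.
* §2 bookkeeping at the CM place: `4c = x² − D` never cancels (`|x²| = |D|` and `|x² − D| < |D|` would make `D∕x²` a principal unit, a square by Hensel, against irreducibility:
  `not_isSquare_trace_sq_sub_four_det_of_not_exists_isRoot`, `isSquare_of_valued_sub_one_lt_one`, `valued_sq_sub_eq_of_not_isSquare`), and a non-square unit has non-square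
  residue (`not_isSquare_residue_of_not_isSquare`).  Hence **`m = min(v(x), N)`**.
* (PART 2, file `…DepthDictionary`) THE HEADS, in the J0diff's own binders: **`typeTwo_depthDictionary_even_ram`** (`N = 2n`): `m ≤ 2n`; `m < 2n → Odd m ∧ 3 ≤ m ∧ τ = 1 ∧ |2u_w − tr g_w| = |ϖ^m|`;
  `m = 2n → τ = −1 ∧ |2u_w − tr g_w| < |ϖ^{2n}|` (regime B: `c ≡ (x∕2)²` to first order, a residue SQUARE, and `(−1)^{m+1} = 1`; regime A-even: `c ≡ −D∕4`, and `D∕ϖ^{2N}` is a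
  residue NON-square; both read through ★ `quadraticChar_residue_eq_hilbertSymbol_typeTwo_of_sub_lt`).  **`typeTwo_depthDictionary_odd_ram`** (`N = 2n+1`): `m ≤ 2n+1`; the same
  regime-B clause; `m = 2n+1 → (τ = 1 ∨ τ = −1) ∧ |2u_w − tr g_w| ≤ |ϖ^{2n+1}|`.  ENGINE (B-p14 (g40) census, F0P3a-p03 (g18) REGIME TABLE v1): `V = m = min(N, d_u)` 164∕164,
  `τ = +1` on all 57 regime-B rows, `τ = −1` on all 66 A-even rows.
HONEST LABEL: HC_CM is proved only modulo the 2 remaining named inputs (hLiu418 24832, h413 24833) until rung 0 closes; unconditional local algebra at one place, count-neutral.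

## References
* [Rogawski1990] J. D. Rogawski, *Automorphic Representations of Unitary Groups in Three Variables*, Ann. of Math. Stud. 123 (1990), §4.9 pp. 54–56, 59 (the type-(2)
  ramified transfer: the depth `m`, the discriminant depth `N`, the sign `τ`).
* [LabesseLanglands1979] J.-P. Labesse, R. P. Langlands, *L-indistinguishability for SL(2)*, Canad. J. Math. 31 (1979), §2 pp. 8–9.
* [Serre1979] J.-P. Serre, *Local Fields*, GTM 67 (1979), Ch. IV §2 Prop. 5 (tame ramified quadratic: `σ` trivial on the residue field), Ch. V §3 Cor. 2, Ch. II §4 Prop. 7 (Hensel).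
-/

set_option autoImplicit false

noncomputable section

open NumberField IsDedekindDomain ValuativeRel Matrix Polynomial
open Literature.NumberTheory.Automorphic Literature.NumberTheory.Automorphic.UnitaryGroup Literature.NumberTheory.QuadraticForms
open Literature.NumberTheory.GaloisRepresentations (HeckeCharacter)
open scoped ValuativeRel MatrixGroups

namespace Literature.NumberTheory.Rogawski1990

/-! ## §1 Generic valued-field lemmas: residual parity and the trace law -/

namespace TypeTwoRamifiedDepth

variable {K : Type*} [Field K] [Valued K (WithZero (Multiplicative ℤ))] (σ : K →+* K) {ϖ : K}

/-- **RESIDUAL PARITY**: if `σ` is residually trivial, `σϖ = −ϖ`, and `|x| = |ϖ^{2k}|`, then `|σx − x| < |x|` (write `x = y·ϖ^{2k}` with `y` a unit; `σ(ϖ^{2k}) = ϖ^{2k}`).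
[cite: Serre1979, Ch. IV §2 Prop. 5] -/
theorem valued_map_sub_lt_of_valued_eq_pow_two_mul (hϖ : Valued.v ϖ = WithZero.exp (-1 : ℤ)) (hσϖ : σ ϖ = -ϖ)
    (hres : ∀ y : K, Valued.v y ≤ 1 → Valued.v (σ y - y) < 1) {x : K} {k : ℕ} (hx : Valued.v x = Valued.v (ϖ ^ (2 * k))) :
    Valued.v (σ x - x) < Valued.v x := by
  have hϖ0 : ϖ ≠ 0 := fun h => by rw [h, map_zero] at hϖ; exact WithZero.zero_ne_coe hϖ
  have hP0 : ϖ ^ (2 * k) ≠ 0 := pow_ne_zero _ hϖ0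
  have hvP0 : Valued.v (ϖ ^ (2 * k)) ≠ 0 := (Valuation.ne_zero_iff _).2 hP0
  have hxy : x = (x * (ϖ ^ (2 * k))⁻¹) * ϖ ^ (2 * k) := by rw [inv_mul_cancel_right₀ hP0]
  have hvy : Valued.v (x * (ϖ ^ (2 * k))⁻¹) = 1 := by
    rw [map_mul, map_inv₀, hx, mul_inv_cancel₀ hvP0]
  generalize hy : x * (ϖ ^ (2 * k))⁻¹ = y at hxy hvy
  have hσP : σ (ϖ ^ (2 * k)) = ϖ ^ (2 * k) := by rw [map_pow, hσϖ, Even.neg_pow (even_two_mul k)]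
  have e : σ x - x = (σ y - y) * ϖ ^ (2 * k) := by rw [hxy, map_mul, hσP]; ring
  rw [e, map_mul, hx]
  calc Valued.v (σ y - y) * Valued.v (ϖ ^ (2 * k)) < 1 * Valued.v (ϖ ^ (2 * k)) :=
        mul_lt_mul_of_pos_right (hres y hvy.le) (zero_lt_iff.2 hvP0)
    _ = Valued.v (ϖ ^ (2 * k)) := one_mul _

/-- **THE TRACE LAW.**  `|2| = 1`; `σu·u = 1`, `σt·δ = t` (the unitarity relations of `u ∈ U(1)` and of `t = tr g`, `δ = det g`, `g ∈ U(2)`; `σδ·δ = 1` is not even needed),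
`|u − 1|, |δ − 1|, |t − 2| < 1.
If `x := 2u − t` satisfies `|σx − x| < |x|` then **`|t² − 4δ| = |2u − t|`**: `σ(x)·uδ + x = 2(δ − t + 1) − (t − 2)(u − 1) =: A` has `|A − 2x| < |x|`, so `|A| = |x|`, and
`t² − 4δ = −(t − 2)x − 2A`. [cite: Rogawski1990, §4.9 p. 55] [cite: LabesseLanglands1979, §2 pp. 8–9] -/
theorem valued_trace_sq_sub_four_det_eq_of_valued_map_sub_lt (h2 : Valued.v (2 : K) = 1) {u t δ : K}
    (hu : σ u * u = 1) (ht : σ t * δ = t)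
    (hu1 : Valued.v (u - 1) < 1) (hδ1 : Valued.v (δ - 1) < 1) (ht2 : Valued.v (t - 2) < 1)
    (hx : Valued.v (σ (2 * u - t) - (2 * u - t)) < Valued.v (2 * u - t)) :
    Valued.v (t ^ 2 - 4 * δ) = Valued.v (2 * u - t) := by
  set x : K := 2 * u - t with hxdef
  have hvx0 : Valued.v x ≠ 0 := ne_of_gt (lt_of_le_of_lt zero_le hx)
  -- the exact identity `σ(x)·uδ + x = A`
  set A : K := 2 * (δ - t + 1) - (t - 2) * (u - 1) with hAdef
  have hσx : σ x = 2 * σ u - σ t := by rw [hxdef, map_sub, map_mul, map_ofNat]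
  have hid : σ x * (u * δ) + x = A := by
    rw [hσx, hAdef, hxdef]; linear_combination (2 * δ) * hu - u * ht
  -- `|uδ − 1| < 1`, `|uδ| = 1`
  have hv1u : Valued.v u = 1 := by
    have e : u = 1 + (u - 1) := by ring
    rw [e, Valuation.map_add_eq_of_lt_left _ (by rwa [Valuation.map_one]), Valuation.map_one]
  have hv1δ : Valued.v δ = 1 := by
    have e : δ = 1 + (δ - 1) := by ring
    rw [e, Valuation.map_add_eq_of_lt_left _ (by rwa [Valuation.map_one]), Valuation.map_one]
  have huδ1 : Valued.v (u * δ - 1) < 1 := by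
    have e : u * δ - 1 = (u - 1) * δ + (δ - 1) := by ring
    rw [e]
    refine Valuation.map_add_lt _ ?_ hδ1
    rw [map_mul, hv1δ, mul_one]; exact hu1
  -- `|A − 2x| < |x|`, hence `|A| = |x|`
  have hA2x : Valued.v (A - 2 * x) < Valued.v x := by
    have e : A - 2 * x = (σ x - x) * (u * δ) + x * (u * δ - 1) := by rw [← hid]; ring
    rw [e]
    refine Valuation.map_add_lt _ ?_ ?_
    · rw [map_mul, map_mul, hv1u, hv1δ, mul_one, mul_one]; exact hx
    · rw [map_mul]
      calc Valued.v x * Valued.v (u * δ - 1) < Valued.v x * 1 := mul_lt_mul_of_pos_left huδ1 (zero_lt_iff.2 hvx0)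
        _ = Valued.v x := mul_one _
  have hv2x : Valued.v (2 * x) = Valued.v x := by rw [map_mul, h2, one_mul]
  have hvA : Valued.v A = Valued.v x := by
    have e : A = 2 * x + (A - 2 * x) := by ring
    rw [e, Valuation.map_add_eq_of_lt_left _ (by rwa [hv2x]), hv2x]
  -- `D = −(t − 2)x − 2A`
  have hD : t ^ 2 - 4 * δ = -((t - 2) * x) + -(2 * A) := by rw [hAdef, hxdef]; ring
  have hsmall : Valued.v (-((t - 2) * x)) < Valued.v (-(2 * A)) := by
    rw [Valuation.map_neg, Valuation.map_neg, map_mul, map_mul, h2, one_mul, hvA]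
    calc Valued.v (t - 2) * Valued.v x < 1 * Valued.v x := mul_lt_mul_of_pos_right ht2 (zero_lt_iff.2 hvx0)
      _ = Valued.v x := one_mul _
  rw [hD, Valuation.map_add_eq_of_lt_right _ hsmall, Valuation.map_neg, map_mul, h2, one_mul, hvA]

omit [Valued K (WithZero (Multiplicative ℤ))] in
/-- `4·(u² − tu + δ) = (2u − t)² − (t² − 4δ)`. [cite: Rogawski1990, §4.9 p. 55] -/
theorem four_mul_quadratic_eq (u t δ : K) : 4 * (u ^ 2 - t * u + δ) = (2 * u - t) ^ 2 - (t ^ 2 - 4 * δ) := by ring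

omit [Valued K (WithZero (Multiplicative ℤ))] in
/-- Over a field with `2 ≠ 0`: if the characteristic polynomial of a `2 × 2` matrix has NO root, its discriminant `tr² − 4 det` is NOT a square
(a square root `s` gives the root `(tr + s)∕2`). [cite: Rogawski1990, §4.9 p. 54] -/
theorem not_isSquare_trace_sq_sub_four_det_of_not_exists_isRoot (h2 : (2 : K) ≠ 0) (g : Matrix (Fin 2) (Fin 2) K)
    (hirr : ¬ ∃ x : K, (g.charpoly).IsRoot x) : ¬ IsSquare (g.trace ^ 2 - 4 * g.det) := by
  rintro ⟨s, hs⟩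
  refine hirr ⟨(g.trace + s) / 2, ?_⟩
  rw [Matrix.charpoly_fin_two, Polynomial.IsRoot.def]
  simp only [eval_add, eval_sub, eval_mul, eval_pow, eval_C, eval_X]
  have h4 : (4 : K) ≠ 0 := by rw [show (4 : K) = 2 * 2 by norm_num]; exact mul_ne_zero h2 h2
  have e : ((g.trace + s) / 2) ^ 2 - g.trace * ((g.trace + s) / 2) + g.det = (s * s - (g.trace ^ 2 - 4 * g.det)) / 4 := by
    field_simp
    ring
  rw [e, ← hs, sub_self, zero_div]

end TypeTwoRamifiedDepth

/-! ## §2 Bookkeeping at the CM place: Hensel and «no cancellation» -/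

section CMPlace

variable (L : Type) [Field L] [NumberField L] [IsCMField L] {v : HeightOneSpectrum (𝓞 ↥(maximalRealSubfield L))}
  (w : PlacesOver L v) (hw : IsCMField.complexConj L • w.1 = w.1)

omit [IsCMField L] in
/-- **A PRINCIPAL UNIT IS A SQUARE** at a place with `|2|_w = 1` (Hensel: `X² − e` has the simple residual root `1`). [cite: Serre1979, Ch. II §4 Prop. 7] -/
theorem isSquare_of_valued_sub_one_lt_one (h2 : IsUnit (2 : 𝒪[(w.1.adicCompletion L)])) {e : w.1.adicCompletion L}
    (he1 : Valued.v (e - 1) < 1) : IsSquare e := by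
  haveI : HenselianLocalRing 𝒪[w.1.adicCompletion L] := Literature.NumberTheory.EllipticCurves.Kramer1981.henselianLocalRing_integer
  have hve : Valued.v e = 1 := by
    have ee : e = 1 + (e - 1) := by ring
    rw [ee, Valuation.map_add_eq_of_lt_left _ (by rwa [Valuation.map_one]), Valuation.map_one]
  have heO : e ∈ 𝒪[w.1.adicCompletion L] := (v_le_one_iff_mem_integer _).1 hve.le
  have hmem : (1 : 𝒪[w.1.adicCompletion L]) ^ 2 - ⟨e, heO⟩ ∈ IsLocalRing.maximalIdeal 𝒪[w.1.adicCompletion L] := by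
    rw [← IsLocalRing.residue_eq_zero_iff, residue_eq_zero_iff_valuation_lt_one, ← v_lt_one_iff_valuation_lt_one]
    push_cast
    rw [one_pow, ← Valuation.map_neg, neg_sub]
    exact he1
  obtain ⟨z, hz⟩ := exists_sq_eq_of_sq_sub_mem_maximalIdeal h2 isUnit_one hmem
  refine ⟨(z : w.1.adicCompletion L), ?_⟩
  have h := congrArg (fun y : 𝒪[w.1.adicCompletion L] => (y : w.1.adicCompletion L)) hz
  simp only at h
  push_cast at h
  rw [← h]; ring

omit [IsCMField L] in
/-- **A NON-SQUARE UNIT HAS A NON-SQUARE RESIDUE** (`|2|_w = 1`): if `res U = r̄²` then `|U − r²| < 1` for a lift `r`, `U∕r²` is a principal unit, a square by Hensel.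
[cite: Serre1979, Ch. II §4 Prop. 7; Ch. V §3 Cor. 2] -/
theorem not_isSquare_residue_of_not_isSquare (h2 : IsUnit (2 : 𝒪[(w.1.adicCompletion L)])) {U : w.1.adicCompletion L} (hU1 : Valued.v U = 1)
    (hU : ¬ IsSquare U) :
    ¬ IsSquare (IsLocalRing.residue 𝒪[w.1.adicCompletion L] ⟨U, (v_le_one_iff_mem_integer U).1 hU1.le⟩) := by
  intro hsq
  obtain ⟨r, hr1, hr⟩ := (Literature.NumberTheory.LocalFields.RamifiedPlaceNormDictionary.isSquare_residue_iff_exists_valued_sub_sq_lt_one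
    L v w hU1).1 hsq
  -- `r` is a unit
  have hvr2 : Valued.v (r ^ 2) = 1 := by
    by_contra hne
    have hlt : Valued.v (r ^ 2) < 1 := lt_of_le_of_ne (by rw [map_pow]; exact pow_le_one₀ zero_le hr1) hne
    have : Valued.v (U - r ^ 2) = Valued.v U := by
      rw [sub_eq_add_neg, Valuation.map_add_eq_of_lt_left _ (by rwa [Valuation.map_neg, hU1])]
    rw [this, hU1] at hr
    exact lt_irrefl _ hr
  have hr0 : r ^ 2 ≠ 0 := fun h => by rw [h, map_zero] at hvr2; exact zero_ne_one hvr2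
  -- `e := U ∕ r²` is a principal unit
  have he1 : Valued.v (U / r ^ 2 - 1) < 1 := by
    have e : U / r ^ 2 - 1 = (U - r ^ 2) / r ^ 2 := by rw [sub_div, div_self hr0]
    rw [e, map_div₀, hvr2, div_one]; exact hr
  obtain ⟨s, hs⟩ := isSquare_of_valued_sub_one_lt_one L w h2 he1
  exact hU ⟨s * r, by rw [show U = (U / r ^ 2) * r ^ 2 by rw [div_mul_cancel₀ _ hr0], hs]; ring⟩

omit [IsCMField L] in
/-- **NO CANCELLATION against a non-square**: if `D` is not a square then `|x² − D| = max(|x|², |D|)` — in the tie `|x²| = |D|` a cancellation would make `D∕x²` a principal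
unit, a square by Hensel. [cite: Serre1979, Ch. II §4 Prop. 7] [cite: Rogawski1990, §4.9 p. 55] -/
theorem valued_sq_sub_eq_of_not_isSquare (h2 : IsUnit (2 : 𝒪[(w.1.adicCompletion L)])) {x D : w.1.adicCompletion L} (hD : ¬ IsSquare D) :
    Valued.v (x ^ 2 - D) = max (Valued.v (x ^ 2)) (Valued.v D) := by
  have hD0 : D ≠ 0 := fun h => hD ⟨0, by rw [h, mul_zero]⟩
  have hvD0 : Valued.v D ≠ 0 := (Valuation.ne_zero_iff _).2 hD0
  rcases lt_trichotomy (Valued.v (x ^ 2)) (Valued.v D) with hlt | heq | hgt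
  · rw [max_eq_right hlt.le, sub_eq_add_neg, Valuation.map_add_eq_of_lt_right _ (by rwa [Valuation.map_neg]), Valuation.map_neg]
  · rw [heq, max_self]
    -- the tie: no cancellation
    have hx0 : x ≠ 0 := by
      intro h; rw [h, zero_pow two_ne_zero, map_zero] at heq; exact hvD0 heq.symm
    have hx20 : x ^ 2 ≠ 0 := pow_ne_zero _ hx0
    have hle : Valued.v (x ^ 2 - D) ≤ Valued.v D := by
      rw [sub_eq_add_neg]
      refine le_trans (Valuation.map_add _ _ _) ?_
      rw [heq, Valuation.map_neg, max_self]
    rcases hle.lt_or_eq with hlt | hEq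
    · exfalso
      -- `D ∕ x²` is a principal unit
      have he1 : Valued.v (D / x ^ 2 - 1) < 1 := by
        have e : D / x ^ 2 - 1 = -((x ^ 2 - D) / x ^ 2) := by field_simp; ring
        rw [e, Valuation.map_neg, map_div₀, heq]
        calc Valued.v (x ^ 2 - D) / Valued.v D < Valued.v D / Valued.v D := div_lt_div_of_pos_right hlt (zero_lt_iff.2 hvD0)
          _ = 1 := div_self hvD0
      obtain ⟨s, hs⟩ := isSquare_of_valued_sub_one_lt_one L w h2 he1
      exact hD ⟨s * x, by rw [show D = (D / x ^ 2) * x ^ 2 by rw [div_mul_cancel₀ _ hx20], hs]; ring⟩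
    · exact hEq
  · rw [max_eq_left hgt.le, sub_eq_add_neg, Valuation.map_add_eq_of_lt_left _ (by rwa [Valuation.map_neg])]

end CMPlace


end Literature.NumberTheory.Rogawski1990

end
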